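import Literature.Barriers.CriticalPhenomena.SupercriticalSAWSpaceFillingHyperspace
import Literature.Barriers.CriticalPhenomena.SupercriticalSAWSpaceFillingWindowRateQuarter
import Literature.Probability.RandomPlanarGeometry.CrossingTraversal
import HarnessLib

/-!
# Weakly space-filling walks violate Kemppainen–Smirnov's Condition G1 and Aizenman–Burchard's
# two-traversal bound: the a-priori-estimate axis of the barrier `SupercriticalSAWSpaceFilling`

Barrier catalogue `Literature/Barriers/CriticalPhenomena/` (D-0021); companion of
`SupercriticalSAWSpaceFilling` (Theorem 1 of H. Duminil-Copin, G. Kozma, A. Yadin, *Supercritical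
self-avoiding walks are space-filling*, Ann. IHP Probab. Stat. 50 (2014) 315–326,
arXiv:1110.3074, proved in the tree as `DKY2014_thm1_holds`) and of its mechanism file
`SupercriticalSAWSpaceFillingProofs` (AUDIT gen 23, 2026-08-16).

## What this file adds

The catalogue entry records (evasion (vii) of `SupercriticalSAWSpaceFilling`) that tightness of
the laws of `γ_δ` is an `x`-robust conclusion COMPATIBLE with onto limits, hence not obstructed by
Theorem 1 on the right of `x_c`. The two standard lattice CRITERIA by which tightness and Loewner
regularity are obtained are not of that kind, and this file proves that both fail for every
weakly space-filling family of SAW laws of the unit disc — in particular for the fugacity-`x` SAW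
of `(𝔻; 1, -1)` at every `x > x_c` (Theorem 1) and along every near-critical window
`x(δ) = x_c + δ^θ`, `0 < θ < 1/4` (`isSpaceFillingLaws_rpow_schedule_quarter`):

* **Kemppainen–Smirnov's Condition G1** (A. Kemppainen, S. Smirnov, *Random curves, scaling limits
  and Loewner evolutions*, Ann. Probab. 45 (2017) 698–779, arXiv:1212.6215, eq. (4): "there exists
  `C > 1` such that for any `(φ, P) ∈ Σ` and for any annulus `A = A(z₀, r, R)` with `0 < C r ≤ R`,
  `P(γ makes a crossing of A which is contained in A^u) ≤ 1/2`"; the tree's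
  `Literature.Probability.RandomPlanarGeometry.ConditionG1`, the time-zero case of `ConditionG2`),
  for the collection of marked laws `(𝔻, 1, -1, law of γ_δ.curve)`, `0 < δ < δ₁`:
  `not_conditionG1_of_isSpaceFillingLaws`, `not_conditionG1_supercritical_unitDisc`,
  `not_conditionG1_image_supercritical`, `exists_not_conditionG1_supercritical`,
  `not_conditionG1_rpow_schedule`. Mechanism: for `R ≤ 1/2` every component of `𝔻 ∩ A(i, r, R)`
  is AVOIDABLE for `(𝔻; 1, -1)` (`inter_planarAnnulus_subset_unforcedPartZero`: the inner circle
  meets `∂𝔻`, and the convex region `𝔻 ∩ {Im z < 1/2}`, which misses `B(i, R)`, joins points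
  arbitrarily close to `1` and `-1`, `not_disconnects_unitDisk_one_neg_one`), so a walk started at
  `a_δ → 1` that visits the open set `𝔻 ∩ B(i, r)` makes an unforced crossing
  (`curve_mem_crossingIn_unforcedPartZero`; the SAW polylines of `𝔻_δ` run in the OPEN disc,
  `range_curve_subset_unitDisk`), and weak space-filling makes that visit certain in the limit
  (`tendsto_lawAt_not_crossingIn`) — against the bound `1/2` at `r = 1/(2C)`, `R = 1/2`. This is
  the source's own remark on the UST Peano curve, "it is a curve otherwise eligible but it fails to
  satisfy Condition G2 … since it is space filling it will make an unforced crossing of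
  `A(z₀,r,R)` with probability 1 if there are any sites which are disconnected from `a_δ` and `b_δ`
  by a component of `A(z₀,r,R)` … Condition G2 is only relevant to the case `0 ≤ κ < 8`" (§4.5),
  transplanted to weakly space-filling lattice families.
* **Aizenman–Burchard's hypothesis H1 at `k = 2` with a positive exponent** (M. Aizenman,
  A. Burchard, *Hölder regularity and dimension bounds for random curves*, Duke Math. J. 99 (1999)
  419–453, arXiv:math/9801027, §1.b (1.3): "`Prob_δ(D(x; r, R) is traversed by k separate segments)
  ≤ K_k (r/R)^{λ(k)}` uniformly in `δ`"; the clause `λ(2) > 0` is what bounds the dimension of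
  scaling limits, `dim_H 𝒞 ≤ d - λ(2)` (Thm 1.2), and for spanning trees "`λ(1) = 0` … Nevertheless
  the hypotheses H1 and H2 are valid (with `λ(2) > 0`)" (§1.d / Appendix)): no bound
  `P_δ[the polyline of γ_δ traverses D(z; ρ, R') twice] ≤ K (ρ/R')^λ`, `λ > 0`, uniform in
  `δ ∈ (0, δ₀]`, `z`, `δ ≤ ρ < R' ≤ 1`, holds for a weakly space-filling family
  (`not_twoTraversalBound_of_isSpaceFillingLaws`, `not_twoTraversalBound_supercritical`,
  `not_twoTraversalBound_rpow_schedule`): a visit to `𝔻 ∩ B(0, ρ)` between endpoints near `±1`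
  is two separate traversals of `D(0; ρ, 1/2)` (`hasTraversals_two_of_dist_lt`,
  `polyline_hasTraversals_two`, `tendsto_lawAt_not_hasTraversals_two`).

## Reading for planners (barrier bookkeeping)

* The crossing / regularity axis SPLITS. Single-unforced-crossing bounds (KS G1, G2, G3, C2, C3)
  and one-ball / two-traversal power bounds (AB's `λ(2) > 0`, the "one-arm" or dimension-`< 2`
  clause) are PROBLEM-10-TYPE conclusions: false at every `x > x_c` by a declaration of this file,
  plausible at `0 < x < x_c` (the walk follows the chord; no declaration), i.e. of LEFT type (xii)
  — a proof of `KSAdmissibleG1` / `KSConditionG2` / an RSW-type annulus estimate for the critical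
  SAW (items of the routes `SAWParafermion`, `SAWRenewalTightness`, `SAWSchrammPassage`,
  `SAWTipEnvironment`, …) must use `x = x_c` or inputs valid only for `x ≤ x_c`; it cannot come
  from ingredients insensitive to raising the fugacity (sub-multiplicativity, unfolding,
  comparison from above), and by `not_conditionG1_rpow_schedule` not even an error `+δ^θ`,
  `θ < 1/4`, in the fugacity is tolerated.
* Traversal bounds with a SHELL-DEPENDENT multiplicity `k(z, ρ, R)` and one exponent `λ > d` — the
  form of the tree's proved criterion `isTightMeasureSet_of_traversalBounds`
  (`CurveTightness.lean`) and of the route item `SAWRenewalTightness.ShellCrossingBound` — and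
  Kemppainen's UST-adapted confining-quadrilateral condition (§4.5: "the probability [of] more than
  2 crossings in such a component is small") are ONTO-COMPATIBLE (the UST Peano curve, SLE₈,
  satisfies them): like tightness itself (evasion (vii)) they are refuted by nothing in the
  catalogue on the right of `x_c`, and right-uniform versions would pass to `x_c` by the
  fixed-mesh continuity `continuousOn_lawAt_apply` — in substance such a uniform bound across the
  whole near-critical crossover is at least as hard as the critical one (the barrier's standing
  remark: the work is relocated into uniformity, not removed).

Everything is proved; no named fact is introduced. Inputs: `DKY2014_thm1_holds`,
`isSpaceFillingFamily_of_DKY2014_thm1`, `isSpaceFillingLaws_rpow_schedule_quarter`,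
`isProbabilityMeasure_lawAt`, `range_curve_subset_unitDisk`, `tendsto_meshPoint_of_isClosestSite`,
`Curve.HasTraversals.makesCrossing` (`CrossingTraversal.lean`). Mathlib: `isPreconnected_sphere`,
`IsPreconnected.intermediate_value`, `intermediate_value_Icc`, `Convex.isPathConnected`,
`IsPathConnected.joinedIn`, `JoinedIn.mono`, `frontier_ball`, `Measure.le_map_apply`,
`measure_add_measure_compl`, `Real.rpow_inv_rpow`.

## References

* H. Duminil-Copin, G. Kozma, A. Yadin, *Supercritical self-avoiding walks are space-filling*,
  Ann. Inst. Henri Poincaré Probab. Stat. 50 (2014) 315–326, arXiv:1110.3074: §1 p. 2 (the weak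
  sense of space-filling), Theorem 1 (p. 2). [DuminilCopinKozmaYadin2014]
* A. Kemppainen, S. Smirnov, *Random curves, scaling limits and Loewner evolutions*, Ann. Probab.
  45 (2017) 698–779, arXiv:1212.6215: §1.1 eq. (2)–(4) (annuli, `A^u`, Condition G1), Def. 2.3,
  §2.1.3 Condition G2, §4.5 (the UST Peano curve fails the condition). [KemppainenSmirnov2017]
* M. Aizenman, A. Burchard, *Hölder regularity and dimension bounds for random curves*, Duke Math.
  J. 99 (1999) 419–453, arXiv:math/9801027: §1.b (1.3) (hypothesis H1), Thm 1.2
  (`dim_H ≤ d - λ(2)`), Appendix (random spanning trees: `λ(1) = 0`, `λ(2) > 0`).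
  [AizenmanBurchard1999]
-/

noncomputable section

open MeasureTheory Filter Topology Metric Set Literature.Probability.LatticeModels
  Literature.Probability.Percolation Literature.Probability.RandomPlanarGeometry
  Literature.Probability.RandomPlanarGeometry.SAW
open scoped ENNReal NNReal unitInterval

namespace Literature.Barriers.CriticalPhenomena

namespace SupercriticalSAW

/-! ### Crossings and traversals of an annulus by a curve entering the inner disc -/

section Curves

variable {γ : Curve ℂ} {z₀ : ℂ} {r R : ℝ}

/-- A crossing of `A(z₀, r, R)` is a crossing "contained in `S`" as soon as `S` contains every
point of the curve lying in the annulus. [cite: KemppainenSmirnov2017, Def. 1.1] -/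
theorem makesCrossingIn_of_forall_mem {S : Set ℂ} (h : γ.MakesCrossingIn z₀ r R univ)
    (hS : ∀ u : I, γ u ∈ planarAnnulus z₀ r R → γ u ∈ S) : γ.MakesCrossingIn z₀ r R S := by
  obtain ⟨s, t, hst, hends, hin⟩ := h
  exact ⟨s, t, hst, hends, fun u hsu hut => ⟨(hin u hsu hut).1, hS u (hin u hsu hut).1⟩⟩

/-- **A curve outside the open disc `B(z₀, R)` at some time and inside the closed disc
`B̄(z₀, r)`, `r < R`, at a later time makes a crossing of `A(z₀, r, R)`** in the sense of
Kemppainen–Smirnov (Def. 1.1), contained in any set `S` containing the points of the curve in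
the annulus (one Aizenman–Burchard traversal contains a crossing,
`Curve.HasTraversals.makesCrossing`). [cite: KemppainenSmirnov2017, Def. 1.1] -/
theorem makesCrossingIn_of_le_dist_of_dist_le (hrR : r < R) {s t : I} (hst : s ≤ t)
    (hs : R ≤ dist (γ s) z₀) (ht : dist (γ t) z₀ ≤ r) {S : Set ℂ}
    (hS : ∀ u : I, γ u ∈ planarAnnulus z₀ r R → γ u ∈ S) : γ.MakesCrossingIn z₀ r R S := by
  have htrav : γ.HasTraversals 1 z₀ r R :=
    ⟨fun _ => s, fun _ => t, fun _ => ⟨hst, Or.inr ⟨hs, ht⟩⟩,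
      fun i j hij => absurd (Fin.lt_def.1 hij) (by omega)⟩
  exact makesCrossingIn_of_forall_mem (htrav.makesCrossing hrR) hS

/-- Intermediate values of the distance to a point along a curve, after a given time: if
`dist (γ t₀) z₀ < c ≤ dist (γ 1) z₀` then `dist (γ t₁) z₀ = c` at some later time `t₁ > t₀`
(real intermediate value theorem pulled back through `projIcc`). [folklore] -/
theorem exists_gt_dist_eq {t₀ : I} {c : ℝ} (hlt : dist (γ t₀) z₀ < c) (h1 : c ≤ dist (γ 1) z₀) :
    ∃ t₁ : I, t₀ < t₁ ∧ dist (γ t₁) z₀ = c := by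
  set g : ℝ → ℝ := fun u => dist (γ (projIcc 0 1 zero_le_one u)) z₀ with hg
  have hgc : Continuous g := (γ.continuous.comp continuous_projIcc).dist continuous_const
  have hg₀ : g t₀ = dist (γ t₀) z₀ := by
    simp only [hg, projIcc_val]
  have hg₁ : g 1 = dist (γ 1) z₀ := by
    simp only [hg, projIcc_right]
    rfl
  have hmem : c ∈ Icc (g t₀) (g 1) := ⟨by rw [hg₀]; exact hlt.le, by rwa [hg₁]⟩
  obtain ⟨u, hu, hgu⟩ :=
    intermediate_value_Icc (show ((t₀ : ℝ)) ≤ 1 from t₀.2.2) hgc.continuousOn hmem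
  have hu01 : u ∈ Icc (0 : ℝ) 1 := ⟨t₀.2.1.trans hu.1, hu.2⟩
  have hproj : projIcc 0 1 zero_le_one u = ⟨u, hu01⟩ := projIcc_of_mem _ hu01
  refine ⟨⟨u, hu01⟩, ?_, ?_⟩
  · rcases hu.1.lt_or_eq with h | h
    · exact h
    · exfalso
      have : g u = dist (γ t₀) z₀ := by
        rw [hg]
        simp only
        rw [hproj]
        congr 2
        exact Subtype.ext h.symm
      linarith
  · rw [← hgu, hg]
    simp only
    rw [hproj]

/-- **Two separate traversals from one visit.** A curve outside the open disc `B(z₀, R)` at both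
ends and inside the OPEN disc `B(z₀, r)`, `r < R`, at some time traverses the shell
`D(z₀; r, R)` twice in the sense of Aizenman–Burchard — inwards up to that time, outwards from a
slightly later time still in `B̄(z₀, r)`. [cite: AizenmanBurchard1999, §1.b (1.3)] -/
theorem hasTraversals_two_of_dist_lt (hrR : r < R) (h0 : R ≤ dist (γ 0) z₀)
    (h1 : R ≤ dist (γ 1) z₀) {t₀ : I} (ht₀ : dist (γ t₀) z₀ < r) :
    γ.HasTraversals 2 z₀ r R := by
  obtain ⟨t₁, ht₀t₁, ht₁⟩ := exists_gt_dist_eq ht₀ (hrR.le.trans h1)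
  refine ⟨![0, t₁], ![t₀, 1], ?_, ?_⟩
  · intro i
    fin_cases i
    · exact ⟨bot_le, Or.inr ⟨h0, ht₀.le⟩⟩
    · exact ⟨le_top, Or.inl ⟨ht₁.le, h1⟩⟩
  · intro i j hij
    fin_cases i <;> fin_cases j
    · exact absurd hij (lt_irrefl _)
    · simpa using ht₀t₁
    · exact absurd (Fin.lt_def.1 hij) (by decide)
    · exact absurd hij (lt_irrefl _)

end Curves

/-! ### The boundary annulus `A(i, r, R)`, `R ≤ 1/2`, of `(𝔻; 1, -1)` is avoidable at time zero -/

section Geometry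

/-- Points of the lower region `{Im z < 1/2}` are at distance `> 1/2` from `i`. [folklore] -/
theorem half_lt_dist_I_of_im_lt {z : ℂ} (hz : z.im < 2⁻¹) : 2⁻¹ < dist z Complex.I := by
  have h1 : |(z - Complex.I).im| ≤ ‖z - Complex.I‖ := Complex.abs_im_le_norm _
  have h2 : (z - Complex.I).im = z.im - 1 := by simp
  rw [dist_eq_norm]
  rw [h2, abs_sub_comm, abs_of_pos (by linarith)] at h1
  linarith

/-- **No subset of `B(i, R)`, `R ≤ 1/2`, disconnects `1` from `-1` in the unit disc** in the
sense of Kemppainen–Smirnov's Def. 2.3: points of the convex region `𝔻 ∩ {Im z < 1/2}`, which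
misses `B(i, R)`, lie arbitrarily close to `1` and to `-1` and are joined inside it.
[cite: KemppainenSmirnov2017, Def. 2.3] -/
theorem not_disconnects_unitDisk_one_neg_one {C : Set ℂ} {R : ℝ} (hR : R ≤ 2⁻¹)
    (hC : C ⊆ ball Complex.I R) : ¬ Disconnects unitDisk C 1 (-1) := by
  rintro ⟨N₁, hN₁, N₂, hN₂, h⟩
  set K : Set ℂ := unitDisk ∩ {z | z.im < 2⁻¹} with hK
  have hKconv : Convex ℝ K := (convex_ball (0 : ℂ) 1).inter (convex_halfSpace_im_lt _)
  have hKsub : K ⊆ unitDisk \ C := by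
    rintro z ⟨hzD, hzim⟩
    refine ⟨hzD, fun hzC => ?_⟩
    have h₁ := mem_ball.1 (hC hzC)
    have h₂ := half_lt_dist_I_of_im_lt hzim
    linarith
  obtain ⟨ε₁, hε₁, hball₁⟩ := Metric.mem_nhds_iff.1 hN₁
  obtain ⟨ε₂, hε₂, hball₂⟩ := Metric.mem_nhds_iff.1 hN₂
  set ε : ℝ := min (min ε₁ ε₂ / 2) 2⁻¹ with hε
  have hε0 : 0 < ε := lt_min (by positivity) (by norm_num)
  have hεε₁ : ε < ε₁ := by
    have : min ε₁ ε₂ / 2 < ε₁ := by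
      have := min_le_left ε₁ ε₂
      linarith
    exact (min_le_left _ _).trans_lt this
  have hεε₂ : ε < ε₂ := by
    have : min ε₁ ε₂ / 2 < ε₂ := by
      have := min_le_right ε₁ ε₂
      linarith
    exact (min_le_left _ _).trans_lt this
  have hε1 : ε ≤ 2⁻¹ := min_le_right _ _
  set x : ℂ := ((1 - ε : ℝ) : ℂ) with hx
  set y : ℂ := ((-(1 - ε) : ℝ) : ℂ) with hy
  have hnorm : ∀ s : ℝ, |s| < 1 → ((s : ℂ)) ∈ unitDisk := fun s hs => by
    rw [unitDisk, mem_ball, dist_zero_right, Complex.norm_real, Real.norm_eq_abs]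
    exact hs
  have hxK : x ∈ K := by
    refine ⟨hnorm _ ?_, ?_⟩
    · rw [abs_of_nonneg (by linarith)]
      linarith
    · show ((1 - ε : ℝ) : ℂ).im < 2⁻¹
      rw [Complex.ofReal_im]
      norm_num
  have hyK : y ∈ K := by
    refine ⟨hnorm _ ?_, ?_⟩
    · rw [abs_neg, abs_of_nonneg (by linarith)]
      linarith
    · show ((-(1 - ε) : ℝ) : ℂ).im < 2⁻¹
      rw [Complex.ofReal_im]
      norm_num
  have hx₁ : x ∈ N₁ := hball₁ (by
    rw [mem_ball, hx, dist_eq_norm]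
    have : ((1 - ε : ℝ) : ℂ) - 1 = ((-ε : ℝ) : ℂ) := by push_cast; ring
    rw [this, Complex.norm_real, Real.norm_eq_abs, abs_neg, abs_of_pos hε0]
    exact hεε₁)
  have hy₂ : y ∈ N₂ := hball₂ (by
    rw [mem_ball, hy, dist_eq_norm]
    have : ((-(1 - ε) : ℝ) : ℂ) - -1 = ((ε : ℝ) : ℂ) := by push_cast; ring
    rw [this, Complex.norm_real, Real.norm_eq_abs, abs_of_pos hε0]
    exact hεε₂)
  have hjoin : JoinedIn K x y := (hKconv.isPathConnected ⟨x, hxK⟩).joinedIn x hxK y hyK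
  exact h x ⟨hx₁, hKsub hxK⟩ y ⟨hy₂, hKsub hyK⟩ (hjoin.mono hKsub)

/-- The circle `∂B(i, r)`, `0 < r ≤ 1`, meets the unit circle `∂𝔻` (intermediate value of the
norm on the connected circle, between `(1 - r) i` and `(1 + r) i`). [folklore] -/
theorem sphere_I_inter_frontier_unitDisk_nonempty {r : ℝ} (hr : 0 < r) (hr1 : r ≤ 1) :
    (Metric.sphere Complex.I r ∩ frontier unitDisk).Nonempty := by
  have hrank : 1 < Module.rank ℝ ℂ := by simp
  have hpre : IsPreconnected (Metric.sphere Complex.I r) := isPreconnected_sphere hrank Complex.I r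
  set p₁ : ℂ := ((1 - r : ℝ) : ℂ) * Complex.I with hp₁def
  set p₂ : ℂ := ((1 + r : ℝ) : ℂ) * Complex.I with hp₂def
  have hp₁ : p₁ ∈ Metric.sphere Complex.I r := by
    rw [Metric.mem_sphere, dist_eq_norm, hp₁def]
    have : ((1 - r : ℝ) : ℂ) * Complex.I - Complex.I = ((-r : ℝ) : ℂ) * Complex.I := by push_cast; ring
    rw [this, norm_mul, Complex.norm_real, Complex.norm_I, mul_one, Real.norm_eq_abs, abs_neg,
      abs_of_pos hr]
  have hp₂ : p₂ ∈ Metric.sphere Complex.I r := by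
    rw [Metric.mem_sphere, dist_eq_norm, hp₂def]
    have : ((1 + r : ℝ) : ℂ) * Complex.I - Complex.I = ((r : ℝ) : ℂ) * Complex.I := by push_cast; ring
    rw [this, norm_mul, Complex.norm_real, Complex.norm_I, mul_one, Real.norm_eq_abs, abs_of_pos hr]
  have hn₁ : ‖p₁‖ = 1 - r := by
    rw [hp₁def, norm_mul, Complex.norm_real, Complex.norm_I, mul_one, Real.norm_eq_abs,
      abs_of_nonneg (by linarith)]
  have hn₂ : ‖p₂‖ = 1 + r := by
    rw [hp₂def, norm_mul, Complex.norm_real, Complex.norm_I, mul_one, Real.norm_eq_abs,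
      abs_of_nonneg (by linarith)]
  obtain ⟨z, hz, hnz⟩ := hpre.intermediate_value hp₁ hp₂ continuous_norm.continuousOn
    ⟨show ‖p₁‖ ≤ 1 by rw [hn₁]; linarith, show (1 : ℝ) ≤ ‖p₂‖ by rw [hn₂]; linarith⟩
  refine ⟨z, hz, ?_⟩
  rw [unitDisk, frontier_ball (0 : ℂ) one_ne_zero, Metric.mem_sphere, dist_zero_right]
  exact hnz

/-- **The part of `A(i, r, R)` inside the unit disc is avoidable at time zero for `(𝔻; 1, -1)`**
(`unforcedPartZero`, Kemppainen–Smirnov eq. (3)): the inner circle meets `∂𝔻` and no component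
of `𝔻 ∩ A(i, r, R)` disconnects `1` from `-1`, for `0 < r < R ≤ 1/2`; hence EVERY crossing of this
annulus by a curve running in `𝔻` is unforced. [cite: KemppainenSmirnov2017, §1.1 eq. (3)] -/
theorem inter_planarAnnulus_subset_unforcedPartZero {r R : ℝ} (hr : 0 < r) (hrR : r < R)
    (hR : R ≤ 2⁻¹) : unitDisk ∩ planarAnnulus Complex.I r R ⊆ unforcedPartZero unitDisk 1 (-1) Complex.I r R := by
  intro z hz
  refine ⟨sphere_I_inter_frontier_unitDisk_nonempty hr (by linarith), hz, ?_⟩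
  refine not_disconnects_unitDisk_one_neg_one hR ?_
  exact (connectedComponentIn_subset _ _).trans fun w hw => mem_ball.2 hw.2.2

end Geometry

/-! ### SAW polylines of the disc -/

section Lattice

variable {δ : ℝ} {u v : Site 2}

/-- The parametrised polyline of a SAW of `𝔻_δ` (the representative defining `γ.curve`).
[cite: LawlerSchrammWerner2004SAW, §3.4.2] -/
theorem curve_eq_mk_polyline (γ : DomainSAW unitDisk δ u v) :
    γ.curve = CurveClass.mk ⟨γ.walk.toCurve (meshPoint δ)⟩ := rfl

/-- The polyline of a walk ends at the mesh point of its final site. [folklore] -/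
theorem toCurve_meshPoint_apply_one {Ω : Set ℂ} (w : (discreteDomainGraph Ω δ).Walk u v) :
    w.toCurve (meshPoint δ) 1 = meshPoint δ v := by
  cases w with
  | nil => simp [SimpleGraph.Walk.toCurve, polyline]
  | cons h q => simp [SimpleGraph.Walk.toCurve, polyline_apply_one, List.getLast_map]

/-- The polyline starts at the mesh point of the starting site. [folklore] -/
theorem polyline_apply_zero' (γ : DomainSAW unitDisk δ u v) :
    (⟨γ.walk.toCurve (meshPoint δ)⟩ : Curve ℂ) 0 = meshPoint δ u :=
  SimpleGraph.Walk.toCurve_apply_zero _ _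

/-- The polyline ends at the mesh point of the final site. [folklore] -/
theorem polyline_apply_one' (γ : DomainSAW unitDisk δ u v) :
    (⟨γ.walk.toCurve (meshPoint δ)⟩ : Curve ℂ) 1 = meshPoint δ v :=
  toCurve_meshPoint_apply_one _

/-- Points of the polyline lie in the open unit disc (convexity; the start is a site of `𝔻_δ`).
[folklore] -/
theorem polyline_apply_mem_unitDisk (γ : DomainSAW unitDisk δ u v) (hu : u ∈ meshDomain unitDisk δ)
    (t : I) : (⟨γ.walk.toCurve (meshPoint δ)⟩ : Curve ℂ) t ∈ unitDisk :=
  range_curve_subset_unitDisk (γ := γ) hu ⟨t, rfl⟩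

/-- A visited site is passed by the polyline at some parameter. [folklore] -/
theorem exists_polyline_apply_eq (γ : DomainSAW unitDisk δ u v) {w : Site 2}
    (hw : w ∈ γ.walk.support) : ∃ t : I, (⟨γ.walk.toCurve (meshPoint δ)⟩ : Curve ℂ) t = meshPoint δ w :=
  SimpleGraph.Walk.mem_range_toCurve (meshPoint δ) γ.walk hw

/-- **Reaching `B̄(i, r)` from a start outside `B(i, R)` is an unforced crossing at time zero.**
For a SAW `γ` of `𝔻_δ` starting at a site `u ∈ 𝔻_δ` with `R ≤ |δu - i|` and visiting a site `w`
with `|δw - i| ≤ r`, `0 < r < R ≤ 1/2`, the class `γ.curve` makes a crossing of `A(i, r, R)`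
contained in the avoidable set `A^u` of `(𝔻; 1, -1)` — the event bounded by `1/2` in
Kemppainen–Smirnov's Condition G1. [cite: KemppainenSmirnov2017, §1.1 eq. (3)-(4)] -/
theorem curve_mem_crossingIn_unforcedPartZero {r R : ℝ} (hr : 0 < r) (hrR : r < R) (hR : R ≤ 2⁻¹)
    (γ : DomainSAW unitDisk δ u v) (hu : u ∈ meshDomain unitDisk δ) (huR : R ≤ dist (meshPoint δ u) Complex.I)
    {w : Site 2} (hw : w ∈ γ.walk.support) (hwr : dist (meshPoint δ w) Complex.I ≤ r) :
    γ.curve ∈ CurveClass.crossingIn Complex.I r R (unforcedPartZero unitDisk 1 (-1) Complex.I r R) := by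
  obtain ⟨t, ht⟩ := exists_polyline_apply_eq γ hw
  refine ⟨⟨γ.walk.toCurve (meshPoint δ)⟩, rfl, ?_⟩
  refine makesCrossingIn_of_le_dist_of_dist_le hrR (show (0 : I) ≤ t from t.2.1) ?_ ?_ ?_
  · rw [polyline_apply_zero']
    exact huR
  · rw [ht]
    exact hwr
  · intro s hs
    exact inter_planarAnnulus_subset_unforcedPartZero hr hrR hR ⟨polyline_apply_mem_unitDisk γ hu s, hs⟩

/-- **One visit, two traversals.** A SAW of `𝔻_δ` whose endpoints are at distance `≥ R'` from
`z` and which visits a site in the open disc `B(z, ρ)`, `ρ < R'`, has a polyline traversing the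
shell `D(z; ρ, R')` twice. [cite: AizenmanBurchard1999, §1.b (1.3)] -/
theorem polyline_hasTraversals_two {z : ℂ} {ρ R' : ℝ} (hρR : ρ < R') (γ : DomainSAW unitDisk δ u v)
    (huz : R' ≤ dist (meshPoint δ u) z) (hvz : R' ≤ dist (meshPoint δ v) z)
    {w : Site 2} (hw : w ∈ γ.walk.support) (hwρ : dist (meshPoint δ w) z < ρ) :
    (⟨γ.walk.toCurve (meshPoint δ)⟩ : Curve ℂ).HasTraversals 2 z ρ R' := by
  obtain ⟨t, ht⟩ := exists_polyline_apply_eq γ hw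
  refine hasTraversals_two_of_dist_lt hρR ?_ ?_ (t₀ := t) ?_
  · rw [polyline_apply_zero']
    exact huz
  · rw [polyline_apply_one']
    exact hvz
  · rw [ht]
    exact hwρ

end Lattice

/-! ### Weakly space-filling families: unforced crossings and double traversals with
probability tending to one -/

section Family

variable {X : ℝ → ℝ} {A B : ℝ → Site 2}

/-- **Lattice side, Kemppainen–Smirnov.** For a weakly space-filling family of fugacity-`X(δ)`
SAW laws of the disc (`IsSpaceFillingLaws`; constant `X = x > x_c` is Theorem 1 of the source,
`X(δ) = x_c + δ^θ` with `θ < 1/4` is `isSpaceFillingLaws_rpow_schedule_quarter`) whose starting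
sites lie in `𝔻_δ` and tend to `1`, the probability that `γ_δ.curve` makes NO crossing of
`A(i, r, R)` inside the avoidable set of `(𝔻; 1, -1)` (`0 < r < R ≤ 1/2`) tends to `0`: such
walks avoid the open set `𝔻 ∩ B(i, r)`. [cite: DuminilCopinKozmaYadin2014, §1 (When x > 1/μ)] -/
theorem tendsto_lawAt_not_crossingIn
    (hfill : IsSpaceFillingLaws unitDisk A B fun δ => lawAt (X δ) unitDisk δ (A δ) (B δ))
    (hA : ∀ δ : ℝ, 0 < δ → A δ ∈ meshDomain unitDisk δ)
    (hA1 : Tendsto (fun δ => meshPoint δ (A δ)) (𝓝[>] (0 : ℝ)) (𝓝 1))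
    {r R : ℝ} (hr : 0 < r) (hrR : r < R) (hR : R ≤ 2⁻¹) :
    Tendsto (fun δ => lawAt (X δ) unitDisk δ (A δ) (B δ)
      {γ | γ.curve ∉ CurveClass.crossingIn Complex.I r R (unforcedPartZero unitDisk 1 (-1) Complex.I r R)})
      (𝓝[>] (0 : ℝ)) (𝓝 0) := by
  set U : Set ℂ := unitDisk ∩ ball Complex.I r with hU
  have hUo : IsOpen U := isOpen_unitDisk.inter isOpen_ball
  have hUD : U ⊆ unitDisk := inter_subset_left
  have hUne : U.Nonempty := by
    refine ⟨((1 - r / 2 : ℝ) : ℂ) * Complex.I, ?_, ?_⟩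
    · rw [unitDisk, mem_ball, dist_zero_right, norm_mul, Complex.norm_real, Complex.norm_I, mul_one,
        Real.norm_eq_abs, abs_of_nonneg (by linarith)]
      linarith
    · rw [mem_ball, dist_eq_norm]
      have : ((1 - r / 2 : ℝ) : ℂ) * Complex.I - Complex.I = ((-(r / 2) : ℝ) : ℂ) * Complex.I := by
        push_cast; ring
      rw [this, norm_mul, Complex.norm_real, Complex.norm_I, mul_one, Real.norm_eq_abs, abs_neg,
        abs_of_pos (by positivity)]
      linarith
  have hvis := hfill U hUo hUD hUne
  -- eventually the start is outside `B(i, R)`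
  have hfar : ∀ᶠ δ in 𝓝[>] (0 : ℝ), R ≤ dist (meshPoint δ (A δ)) Complex.I := by
    have h1 : R < dist (1 : ℂ) Complex.I := by
      have : (1 : ℝ) ≤ dist (1 : ℂ) Complex.I := by
        rw [dist_eq_norm]
        have := Complex.abs_re_le_norm (1 - Complex.I)
        simpa using this
      linarith
    exact ((hA1.dist tendsto_const_nhds).eventually (lt_mem_nhds h1)).mono fun δ h => h.le
  have hpos : ∀ᶠ δ in 𝓝[>] (0 : ℝ), 0 < δ := self_mem_nhdsWithin
  refine tendsto_of_tendsto_of_tendsto_of_le_of_le' tendsto_const_nhds hvis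
    (Eventually.of_forall fun _ => zero_le) ?_
  filter_upwards [hfar, hpos] with δ hδR hδ
  refine measure_mono fun γ hγ => ?_
  intro w hw hwU
  exact hγ (curve_mem_crossingIn_unforcedPartZero hr hrR hR γ (hA δ hδ) hδR hw
    (mem_ball.1 hwU.2).le)

/-- **Lattice side, Aizenman–Burchard.** For a weakly space-filling family of fugacity-`X(δ)` SAW
laws of the disc whose endpoint mesh points tend to `a`, `b`, and a shell `D(z; ρ, R')`
(`ρ < R'`) with `|a - z|, |b - z| > R'` and `𝔻 ∩ B(z, ρ) ≠ ∅`, the probability that the polyline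
of `γ_δ` does NOT traverse the shell twice tends to `0`. [cite: DuminilCopinKozmaYadin2014, §1 (When x > 1/μ)] -/
theorem tendsto_lawAt_not_hasTraversals_two
    (hfill : IsSpaceFillingLaws unitDisk A B fun δ => lawAt (X δ) unitDisk δ (A δ) (B δ)) {a b : ℂ}
    (hA1 : Tendsto (fun δ => meshPoint δ (A δ)) (𝓝[>] (0 : ℝ)) (𝓝 a))
    (hB1 : Tendsto (fun δ => meshPoint δ (B δ)) (𝓝[>] (0 : ℝ)) (𝓝 b))
    {z : ℂ} {ρ R' : ℝ} (hρR : ρ < R') (haz : R' < dist a z) (hbz : R' < dist b z)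
    (hz : (unitDisk ∩ ball z ρ).Nonempty) :
    Tendsto (fun δ => lawAt (X δ) unitDisk δ (A δ) (B δ)
      {γ | ¬ (⟨γ.walk.toCurve (meshPoint δ)⟩ : Curve ℂ).HasTraversals 2 z ρ R'})
      (𝓝[>] (0 : ℝ)) (𝓝 0) := by
  have hvis := hfill (unitDisk ∩ ball z ρ) (isOpen_unitDisk.inter isOpen_ball) inter_subset_left hz
  have hfarA : ∀ᶠ δ in 𝓝[>] (0 : ℝ), R' ≤ dist (meshPoint δ (A δ)) z :=
    ((hA1.dist tendsto_const_nhds).eventually (lt_mem_nhds haz)).mono fun δ h => h.le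
  have hfarB : ∀ᶠ δ in 𝓝[>] (0 : ℝ), R' ≤ dist (meshPoint δ (B δ)) z :=
    ((hB1.dist tendsto_const_nhds).eventually (lt_mem_nhds hbz)).mono fun δ h => h.le
  refine tendsto_of_tendsto_of_tendsto_of_le_of_le' tendsto_const_nhds hvis
    (Eventually.of_forall fun _ => zero_le) ?_
  filter_upwards [hfarA, hfarB] with δ hδA hδB
  refine measure_mono fun γ hγ => ?_
  intro w hw hwU
  exact hγ (polyline_hasTraversals_two hρR γ hδA hδB hw (mem_ball.1 hwU.2))

/-- From "the complement has probability `→ 0`" to a contradiction with a bound `≤ 1/2` claimed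
at every mesh `δ ∈ (0, δ₁)`: the step shared by the two refutations below (the laws are
probability measures for endpoints in `𝔻_δ` and positive fugacities). [folklore] -/
theorem false_of_tendsto_of_le_half (hX : ∀ δ : ℝ, 0 < δ → 0 < X δ)
    (hA : ∀ δ : ℝ, 0 < δ → A δ ∈ meshDomain unitDisk δ) (hB : ∀ δ : ℝ, 0 < δ → B δ ∈ meshDomain unitDisk δ)
    (E : ∀ δ : ℝ, Set (DomainSAW unitDisk δ (A δ) (B δ))) {δ₁ : ℝ} (hδ₁ : 0 < δ₁)
    (hlim : Tendsto (fun δ => lawAt (X δ) unitDisk δ (A δ) (B δ) (E δ)ᶜ) (𝓝[>] (0 : ℝ)) (𝓝 0))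
    (hbound : ∀ δ : ℝ, 0 < δ → δ < δ₁ → lawAt (X δ) unitDisk δ (A δ) (B δ) (E δ) ≤ 2⁻¹) : False := by
  have hev : ∀ᶠ δ in 𝓝[>] (0 : ℝ), lawAt (X δ) unitDisk δ (A δ) (B δ) (E δ)ᶜ < 2⁻¹ :=
    hlim.eventually (gt_mem_nhds (by simp))
  obtain ⟨δ, hlt, hδ⟩ := (hev.and (Ioo_mem_nhdsGT hδ₁)).exists
  haveI := isProbabilityMeasure_lawAt hδ.1 (hA δ hδ.1) (hB δ hδ.1) (hX δ hδ.1)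
  have hsum : lawAt (X δ) unitDisk δ (A δ) (B δ) (E δ) +
      lawAt (X δ) unitDisk δ (A δ) (B δ) (E δ)ᶜ = 1 := by
    rw [measure_add_measure_compl MeasurableSpace.measurableSet_top, measure_univ]
  have h : (1 : ℝ≥0∞) < 2⁻¹ + 2⁻¹ := by
    calc (1 : ℝ≥0∞) = _ := hsum.symm
      _ < 2⁻¹ + 2⁻¹ := ENNReal.add_lt_add_of_le_of_lt (measure_ne_top _ _) (hbound δ hδ.1 hδ.2) hlt
  rw [ENNReal.inv_two_add_inv_two] at h
  exact lt_irrefl _ h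

/-- **Weakly space-filling SAW families of `(𝔻; 1, -1)` violate Kemppainen–Smirnov's Condition
G1** (the time-zero geometric bound on an unforced crossing, Ann. Probab. 45 (2017), eq. (4)): if
a collection `Σ` of marked laws contains the time-zero Kemppainen–Smirnov data
`(𝔻, 1, -1, law of γ_δ.curve under P_δ)` of a weakly space-filling family of fugacity-`X(δ)` SAW
laws for all meshes `δ ∈ (0, δ₁)`, then `¬ ConditionG1 Σ`: with `R = 1/2`, `r = 1/(2C)`, the
unforced crossing of `A(i, r, R)` has `P_δ`-probability `→ 1 > 1/2`. This is the source's remark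
on the UST Peano curve ("since it is space filling it will make an unforced crossing … with
probability 1", §4.5) transplanted to any weakly space-filling lattice family.
[cite: KemppainenSmirnov2017, Condition G1 eq. (4) and §4.5] -/
theorem not_conditionG1_of_isSpaceFillingLaws
    (hfill : IsSpaceFillingLaws unitDisk A B fun δ => lawAt (X δ) unitDisk δ (A δ) (B δ))
    (hX : ∀ δ : ℝ, 0 < δ → 0 < X δ) (hA : ∀ δ : ℝ, 0 < δ → A δ ∈ meshDomain unitDisk δ)
    (hB : ∀ δ : ℝ, 0 < δ → B δ ∈ meshDomain unitDisk δ)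
    (hA1 : Tendsto (fun δ => meshPoint δ (A δ)) (𝓝[>] (0 : ℝ)) (𝓝 1))
    {fam : Set MarkedLaw} {δ₁ : ℝ} (hδ₁ : 0 < δ₁)
    (hfam : ∀ δ : ℝ, 0 < δ → δ < δ₁ →
      (⟨unitDisk, 1, -1, (lawAt (X δ) unitDisk δ (A δ) (B δ)).map DomainSAW.curve⟩ : MarkedLaw) ∈ fam) :
    ¬ ConditionG1 fam := by
  rintro ⟨C, hC, hG⟩
  have hC0 : 0 < C := zero_lt_one.trans hC
  set R : ℝ := 2⁻¹ with hRdef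
  set r : ℝ := 2⁻¹ / C with hrdef
  have hr : 0 < r := div_pos (by norm_num) hC0
  have hrR : r < R := by
    rw [hrdef, hRdef, div_lt_iff₀ hC0]
    nlinarith
  have hCr : C * r ≤ R := by
    rw [hrdef, hRdef, mul_div_cancel₀ _ hC0.ne']
  set E : Set (CurveClass ℂ) :=
    CurveClass.crossingIn Complex.I r R (unforcedPartZero unitDisk 1 (-1) Complex.I r R) with hE
  refine false_of_tendsto_of_le_half hX hA hB (fun δ => DomainSAW.curve ⁻¹' E) hδ₁
    (tendsto_lawAt_not_crossingIn hfill hA hA1 hr hrR le_rfl) fun δ hδ hδ' => ?_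
  calc lawAt (X δ) unitDisk δ (A δ) (B δ) (DomainSAW.curve ⁻¹' E)
      ≤ (lawAt (X δ) unitDisk δ (A δ) (B δ)).map DomainSAW.curve E :=
        Measure.le_map_apply (DomainSAW.measurable_of_top _).aemeasurable E
    _ ≤ 2⁻¹ := hG _ (hfam δ hδ hδ') Complex.I r R hr hCr

/-- `1 ≠ -1` in `ℂ`. [folklore] -/
theorem one_ne_neg_one_complex : (1 : ℂ) ≠ -1 := fun h => by
  have h' := congrArg Complex.re h
  norm_num at h'

/-- **The supercritical SAW of `(𝔻; 1, -1)` violates Condition G1 at every `x > x_c`,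
unconditionally.** For closest-site endpoint families `a_δ, b_δ` of `1, -1` (the setting of
Theorem 1 of Duminil-Copin–Kozma–Yadin, `DKY2014_thm1_holds`) and every `δ₁ > 0`, any collection
of marked laws containing the time-zero Kemppainen–Smirnov data of `P_{(𝔻_δ,a_δ,b_δ,x)}`,
`0 < δ < δ₁`, fails `ConditionG1` — a fortiori the stopping-time Condition G2, whose `τ = 0`
case is G1. A proof of G1 / G2 for the CRITICAL self-avoiding walk (the routes' crux
`KSAdmissibleG1`, its disc instance, `KSConditionG2`) can therefore not be fugacity-robust on
the right: it must use `x = x_c`, or inputs valid only for `x ≤ x_c`.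
[cite: DuminilCopinKozmaYadin2014, Theorem 1] [cite: KemppainenSmirnov2017, Condition G1 eq. (4) and §4.5] -/
theorem not_conditionG1_supercritical_unitDisc {x : ℝ} (hxc : criticalFugacity < x)
    (hAB : ∀ δ : ℝ, 0 < δ → IsClosestSite unitDisk δ 1 (A δ) ∧ IsClosestSite unitDisk δ (-1) (B δ))
    {fam : Set MarkedLaw} {δ₁ : ℝ} (hδ₁ : 0 < δ₁)
    (hfam : ∀ δ : ℝ, 0 < δ → δ < δ₁ →
      (⟨unitDisk, 1, -1, (lawAt x unitDisk δ (A δ) (B δ)).map DomainSAW.curve⟩ : MarkedLaw) ∈ fam) :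
    ¬ ConditionG1 fam :=
  not_conditionG1_of_isSpaceFillingLaws (X := fun _ => x)
    (isSpaceFillingLaws_lawAt_iff.2 (isSpaceFillingFamily_of_DKY2014_thm1 DKY2014_thm1_holds
      (by simp) (by simp) one_ne_neg_one_complex hAB hxc))
    (fun _ _ => criticalFugacity_nonneg.trans_lt hxc) (fun δ hδ => (hAB δ hδ).1.1)
    (fun δ hδ => (hAB δ hδ).2.1) (tendsto_meshPoint_of_isClosestSite (by simp) fun δ hδ => (hAB δ hδ).1)
    hδ₁ hfam

/-- The same for the explicit collection `{(𝔻, 1, -1, (P_{(𝔻_δ,a_δ,b_δ,x)}).map curve) : 0 < δ < δ₁}`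
(image form; no auxiliary definition). [cite: KemppainenSmirnov2017, Condition G1 eq. (4)] -/
theorem not_conditionG1_image_supercritical {x : ℝ} (hxc : criticalFugacity < x)
    (hAB : ∀ δ : ℝ, 0 < δ → IsClosestSite unitDisk δ 1 (A δ) ∧ IsClosestSite unitDisk δ (-1) (B δ))
    {δ₁ : ℝ} (hδ₁ : 0 < δ₁) :
    ¬ ConditionG1 ((fun δ : ℝ =>
      (⟨unitDisk, 1, -1, (lawAt x unitDisk δ (A δ) (B δ)).map DomainSAW.curve⟩ : MarkedLaw)) '' Ioo 0 δ₁) :=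
  not_conditionG1_supercritical_unitDisc hxc hAB hδ₁ fun δ hδ hδ' => ⟨δ, ⟨hδ, hδ'⟩, rfl⟩

/-- **Existence form**: for every `x > x_c` there are closest-site endpoint families of `1, -1`
(they exist at every mesh, `exists_closestSiteFamily`) whose supercritical Kemppainen–Smirnov
collections violate G1 below every mesh threshold. [cite: DuminilCopinKozmaYadin2014, Theorem 1] -/
theorem exists_not_conditionG1_supercritical {x : ℝ} (hxc : criticalFugacity < x) :
    ∃ A B : ℝ → Site 2,
      (∀ δ : ℝ, 0 < δ → IsClosestSite unitDisk δ 1 (A δ) ∧ IsClosestSite unitDisk δ (-1) (B δ)) ∧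
      ∀ δ₁ : ℝ, 0 < δ₁ → ¬ ConditionG1 ((fun δ : ℝ =>
        (⟨unitDisk, 1, -1, (lawAt x unitDisk δ (A δ) (B δ)).map DomainSAW.curve⟩ : MarkedLaw)) ''
          Ioo 0 δ₁) := by
  obtain ⟨A, hA⟩ := exists_closestSiteFamily (1 : ℂ)
  obtain ⟨B, hB⟩ := exists_closestSiteFamily (-1 : ℂ)
  exact ⟨A, B, fun δ hδ => ⟨hA δ hδ, hB δ hδ⟩, fun δ₁ hδ₁ =>
    not_conditionG1_image_supercritical hxc (fun δ hδ => ⟨hA δ hδ, hB δ hδ⟩) hδ₁⟩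

/-- **Not even window-robust: Condition G1 fails along the near-critical schedule
`x(δ) = x_c + δ^θ`, `0 < θ < 1/4`** (the windows blocked by the quantitative Theorem 1,
`isSpaceFillingLaws_rpow_schedule_quarter`): the time-zero Kemppainen–Smirnov collection of the
fugacity-`x(δ)` SAW of `(𝔻; 1, -1)` below any mesh `δ₁` violates G1. A δ-uniform proof of G1 for
the critical walk cannot tolerate an error `+δ^θ`, `θ < 1/4`, in the fugacity.
[cite: DuminilCopinKozmaYadin2014, Theorem 1] [cite: KemppainenSmirnov2017, Condition G1 eq. (4)] -/
theorem not_conditionG1_rpow_schedule {θ : ℝ} (hθ0 : 0 < θ) (hθ : θ < 1 / 4)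
    (hAB : ∀ δ : ℝ, 0 < δ → IsClosestSite unitDisk δ 1 (A δ) ∧ IsClosestSite unitDisk δ (-1) (B δ))
    {δ₁ : ℝ} (hδ₁ : 0 < δ₁) :
    ¬ ConditionG1 ((fun δ : ℝ =>
      (⟨unitDisk, 1, -1, (lawAt (criticalFugacity + δ ^ θ) unitDisk δ (A δ) (B δ)).map DomainSAW.curve⟩ :
        MarkedLaw)) '' Ioo 0 δ₁) :=
  not_conditionG1_of_isSpaceFillingLaws (X := fun δ => criticalFugacity + δ ^ θ)
    (isSpaceFillingLaws_rpow_schedule_quarter hθ0 hθ hAB)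
    (fun δ hδ => add_pos_of_nonneg_of_pos criticalFugacity_nonneg (Real.rpow_pos_of_pos hδ θ))
    (fun δ hδ => (hAB δ hδ).1.1) (fun δ hδ => (hAB δ hδ).2.1)
    (tendsto_meshPoint_of_isClosestSite (by simp) fun δ hδ => (hAB δ hδ).1) hδ₁
    fun δ hδ hδ' => ⟨δ, ⟨hδ, hδ'⟩, rfl⟩

/-- **Weakly space-filling families admit no uniform two-traversal power bound.** If the mesh
points of the endpoints tend to `1` and `-1`, there are no `K`, `λ > 0`, `δ₀ > 0` with
`P_δ[the polyline of γ_δ traverses D(z; ρ, R') twice] ≤ K (ρ/R')^λ` for all `δ ∈ (0, δ₀]`,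
all centres `z` and all `δ ≤ ρ < R' ≤ 1` — the `k = 2` instance of Aizenman–Burchard's
hypothesis H1 with a positive exponent `λ(2)`, which is the clause bounding the Hausdorff
dimension of scaling limits by `d - λ(2) < 2` (Duke Math. J. 99 (1999), Thm 1.2): at `z = 0`,
`R' = 1/2` and a fixed small `ρ` the probability tends to `1`.
[cite: AizenmanBurchard1999, §1.b (1.3) and Thm 1.2] -/
theorem not_twoTraversalBound_of_isSpaceFillingLaws
    (hfill : IsSpaceFillingLaws unitDisk A B fun δ => lawAt (X δ) unitDisk δ (A δ) (B δ))
    (hX : ∀ δ : ℝ, 0 < δ → 0 < X δ) (hA : ∀ δ : ℝ, 0 < δ → A δ ∈ meshDomain unitDisk δ)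
    (hB : ∀ δ : ℝ, 0 < δ → B δ ∈ meshDomain unitDisk δ)
    (hA1 : Tendsto (fun δ => meshPoint δ (A δ)) (𝓝[>] (0 : ℝ)) (𝓝 1))
    (hB1 : Tendsto (fun δ => meshPoint δ (B δ)) (𝓝[>] (0 : ℝ)) (𝓝 (-1))) :
    ¬ ∃ K lam δ₀ : ℝ, 0 < lam ∧ 0 < δ₀ ∧ ∀ δ ∈ Ioc (0 : ℝ) δ₀, ∀ (z : ℂ) (ρ R' : ℝ),
        δ ≤ ρ → ρ < R' → R' ≤ 1 →
          lawAt (X δ) unitDisk δ (A δ) (B δ)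
              {γ | (⟨γ.walk.toCurve (meshPoint δ)⟩ : Curve ℂ).HasTraversals 2 z ρ R'} ≤
            ENNReal.ofReal (K * (ρ / R') ^ lam) := by
  rintro ⟨K, lam, δ₀, hlam, hδ₀, hH⟩
  -- a radius `ρ` with `K (2ρ)^λ ≤ 1/2`
  set c : ℝ := 1 / (2 * (|K| + 1)) with hc
  have hK1 : 0 < |K| + 1 := by positivity
  have hc0 : 0 < c := by rw [hc]; positivity
  have hc1 : c ≤ 2⁻¹ := by
    rw [hc, div_le_iff₀ (by positivity)]
    nlinarith [abs_nonneg K]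
  set ρ : ℝ := 2⁻¹ * c ^ lam⁻¹ with hρ
  have hcpow : 0 < c ^ lam⁻¹ := Real.rpow_pos_of_pos hc0 _
  have hcpow1 : c ^ lam⁻¹ ≤ 1 := Real.rpow_le_one hc0.le (hc1.trans (by norm_num)) (inv_nonneg.2 hlam.le)
  have hρ0 : 0 < ρ := by rw [hρ]; positivity
  have hρR : ρ < 2⁻¹ := by
    rw [hρ]
    have : c ^ lam⁻¹ < 1 ∨ c ^ lam⁻¹ = 1 := hcpow1.lt_or_eq
    rcases this with h | h
    · nlinarith
    · exfalso
      have hc' : c < 1 := hc1.trans_lt (by norm_num)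
      have := Real.rpow_lt_one hc0.le hc' (inv_pos.2 hlam)
      linarith
  have hbound_val : K * (ρ / 2⁻¹) ^ lam ≤ 2⁻¹ := by
    have hq : ρ / 2⁻¹ = c ^ lam⁻¹ := by rw [hρ]; field_simp
    rw [hq, Real.rpow_inv_rpow hc0.le hlam.ne']
    calc K * c ≤ |K| * c := mul_le_mul_of_nonneg_right (le_abs_self K) hc0.le
      _ = |K| / (2 * (|K| + 1)) := by rw [hc]; ring
      _ ≤ 2⁻¹ := by
          rw [div_le_iff₀ (by positivity)]
          nlinarith [abs_nonneg K]
  -- the two-traversal probability tends to one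
  have hz : (unitDisk ∩ ball (0 : ℂ) ρ).Nonempty := ⟨0, by simp [unitDisk], mem_ball_self hρ0⟩
  have h1z : (2⁻¹ : ℝ) < dist (1 : ℂ) 0 := by rw [dist_zero_right, norm_one]; norm_num
  have h1z' : (2⁻¹ : ℝ) < dist (-1 : ℂ) 0 := by rw [dist_zero_right, norm_neg, norm_one]; norm_num
  have hlim := tendsto_lawAt_not_hasTraversals_two hfill hA1 hB1 hρR h1z h1z' hz
  refine false_of_tendsto_of_le_half hX hA hB
    (fun δ => {γ | (⟨γ.walk.toCurve (meshPoint δ)⟩ : Curve ℂ).HasTraversals 2 0 ρ 2⁻¹})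
    (lt_min hρ0 hδ₀) hlim fun δ hδ hδ' => ?_
  have hδρ : δ ≤ ρ := (hδ'.trans_le (min_le_left _ _)).le
  have hδδ₀ : δ ≤ δ₀ := (hδ'.trans_le (min_le_right _ _)).le
  calc lawAt (X δ) unitDisk δ (A δ) (B δ)
        {γ | (⟨γ.walk.toCurve (meshPoint δ)⟩ : Curve ℂ).HasTraversals 2 0 ρ 2⁻¹}
      ≤ ENNReal.ofReal (K * (ρ / 2⁻¹) ^ lam) := hH δ ⟨hδ, hδδ₀⟩ 0 ρ 2⁻¹ hδρ hρR (by norm_num)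
    _ ≤ ENNReal.ofReal 2⁻¹ := ENNReal.ofReal_le_ofReal hbound_val
    _ = 2⁻¹ := by rw [ENNReal.ofReal_inv_of_pos two_pos, ENNReal.ofReal_ofNat]

/-- **No uniform two-traversal power bound for the supercritical SAW of `(𝔻; 1, -1)`**, at every
`x > x_c`, unconditionally (closest-site endpoints; Theorem 1 of Duminil-Copin–Kozma–Yadin):
Aizenman–Burchard's hypothesis H1 in its dimension-bounding form `λ(2) > 0` cannot hold
right-uniformly in the fugacity, whereas the tree's tightness criterion
`isTightMeasureSet_of_traversalBounds` (one `k = k(z, ρ, R')` depending on the shell, one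
exponent `λ > d`) is of the kind the UST Peano curve satisfies and is refuted by nothing here.
[cite: DuminilCopinKozmaYadin2014, Theorem 1] [cite: AizenmanBurchard1999, §1.b (1.3) and Thm 1.2] -/
theorem not_twoTraversalBound_supercritical {x : ℝ} (hxc : criticalFugacity < x)
    (hAB : ∀ δ : ℝ, 0 < δ → IsClosestSite unitDisk δ 1 (A δ) ∧ IsClosestSite unitDisk δ (-1) (B δ)) :
    ¬ ∃ K lam δ₀ : ℝ, 0 < lam ∧ 0 < δ₀ ∧ ∀ δ ∈ Ioc (0 : ℝ) δ₀, ∀ (z : ℂ) (ρ R' : ℝ),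
        δ ≤ ρ → ρ < R' → R' ≤ 1 →
          lawAt x unitDisk δ (A δ) (B δ)
              {γ | (⟨γ.walk.toCurve (meshPoint δ)⟩ : Curve ℂ).HasTraversals 2 z ρ R'} ≤
            ENNReal.ofReal (K * (ρ / R') ^ lam) :=
  not_twoTraversalBound_of_isSpaceFillingLaws (X := fun _ => x)
    (isSpaceFillingLaws_lawAt_iff.2 (isSpaceFillingFamily_of_DKY2014_thm1 DKY2014_thm1_holds
      (by simp) (by simp) one_ne_neg_one_complex hAB hxc))
    (fun _ _ => criticalFugacity_nonneg.trans_lt hxc) (fun δ hδ => (hAB δ hδ).1.1)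
    (fun δ hδ => (hAB δ hδ).2.1) (tendsto_meshPoint_of_isClosestSite (by simp) fun δ hδ => (hAB δ hδ).1)
    (tendsto_meshPoint_of_isClosestSite (by simp) fun δ hδ => (hAB δ hδ).2)

/-- **Nor along the windows `x_c + δ^θ`, `0 < θ < 1/4`.** [cite: DuminilCopinKozmaYadin2014, Theorem 1] [cite: AizenmanBurchard1999, §1.b (1.3)] -/
theorem not_twoTraversalBound_rpow_schedule {θ : ℝ} (hθ0 : 0 < θ) (hθ : θ < 1 / 4)
    (hAB : ∀ δ : ℝ, 0 < δ → IsClosestSite unitDisk δ 1 (A δ) ∧ IsClosestSite unitDisk δ (-1) (B δ)) :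
    ¬ ∃ K lam δ₀ : ℝ, 0 < lam ∧ 0 < δ₀ ∧ ∀ δ ∈ Ioc (0 : ℝ) δ₀, ∀ (z : ℂ) (ρ R' : ℝ),
        δ ≤ ρ → ρ < R' → R' ≤ 1 →
          lawAt (criticalFugacity + δ ^ θ) unitDisk δ (A δ) (B δ)
              {γ | (⟨γ.walk.toCurve (meshPoint δ)⟩ : Curve ℂ).HasTraversals 2 z ρ R'} ≤
            ENNReal.ofReal (K * (ρ / R') ^ lam) :=
  not_twoTraversalBound_of_isSpaceFillingLaws (X := fun δ => criticalFugacity + δ ^ θ)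
    (isSpaceFillingLaws_rpow_schedule_quarter hθ0 hθ hAB)
    (fun δ hδ => add_pos_of_nonneg_of_pos criticalFugacity_nonneg (Real.rpow_pos_of_pos hδ θ))
    (fun δ hδ => (hAB δ hδ).1.1) (fun δ hδ => (hAB δ hδ).2.1)
    (tendsto_meshPoint_of_isClosestSite (by simp) fun δ hδ => (hAB δ hδ).1)
    (tendsto_meshPoint_of_isClosestSite (by simp) fun δ hδ => (hAB δ hδ).2)

end Family

end SupercriticalSAW

end Literature.Barriers.CriticalPhenomena
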